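import Mathlib
import Summits.Ventures.PercRepro2.Defs
import Summits.Ventures.PercRepro2.Independence
import Summits.Ventures.PercRepro2.Harris
import Summits.Ventures.PercRepro2.Graph
import Summits.Ventures.PercRepro2.Exploration
import Summits.Ventures.PercRepro2.Events
import Summits.Ventures.PercRepro2.FourFunctions
import Summits.Ventures.PercRepro2.Induced
import Summits.Ventures.PercRepro2.Frontier
import Summits.Ventures.PercRepro2.ObsIndependence
import Summits.Ventures.PercRepro2.BHK
import Summits.Ventures.PercRepro2.BHKEvents
import Summits.Ventures.PercRepro2.VdBKahn
import Summits.Ventures.PercRepro2.BHKAvoid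
import Summits.Ventures.PercRepro2.R2PrimeThreeReduction
import Summits.Ventures.PercRepro2.YBridge
import Summits.Ventures.PercRepro2.Yu1Functionals
import Summits.Ventures.PercRepro2.Yu1Events
import Summits.Ventures.PercRepro2.Yu1
import Summits.Ventures.PercRepro2.LBSplit
import Summits.Ventures.PercRepro2.YDelta
import Summits.Ventures.PercRepro2.SD
import Summits.Ventures.PercRepro2.Threshold
import Summits.Ventures.PercRepro2.Lambda
import Summits.Ventures.PercRepro2.LambdaTau
import Summits.Ventures.PercRepro2.LambdaSlack
import Summits.Ventures.PercRepro2.HF2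
import Summits.Ventures.PercRepro2.Yu2
import Summits.Ventures.PercRepro2.N0
import Summits.Ventures.PercRepro2.Y
import Summits.Ventures.PercRepro2.YDeltaTools
import Summits.Ventures.PercRepro2.ZDelta
import Summits.Ventures.PercRepro2.ZExpand
import Summits.Ventures.PercRepro2.Step0
import Summits.Ventures.PercRepro2.MonoFamily

/-!
# The monotone family meets the location cut (blind cell PercRepro2, typer-1)

`monoStep_a3_iff_Z0Zh`: the step `{a₃} → {a₃, o}` of the monotone light-density family
(`MonoFamily.MonoStep`) is exactly the rung L2 `Z_0 + Z_h ≥ 0` (`Z0ZhNonneg`, row 2′Z0h) —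
ADDENDUM 17 (13)(2): "L2 IS the monotonicity step"; hence `ZDelta` from `MonoStep {a₃} o` and `Z_l ≥ 0`,
and `MonoFam` gives L2 on every instance.
-/

namespace Summit.Ventures.PercRepro2

open UnionCluster Yu1

section MonoFamilyZ

variable {V : Type*} {E : Type*} [Fintype E] [DecidableEq E] [Fintype V] [DecidableEq V]
  {R : Type*} [Field R] [LinearOrder R] [IsStrictOrderedRing R]

omit [Fintype V] in
/-- **The step `{a₃} → {a₃, o}` is L2**: `MonoStep {a₃} o ↔ Z_0 + Z_h ≥ 0`. -/
theorem monoStep_a3_iff_Z0Zh (p : E → R) (ends : E → Sym2 V) (o a₁ a₂ a₃ b : V) :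
    MonoFamily.MonoStep p ends a₁ a₂ b {a₃} o ↔ Z0ZhNonneg p ends o a₁ a₂ a₃ b := by
  rw [MonoFamily.monoStep_a3_iff, Z0ZhNonneg_iff]

omit [Fintype V] in
/-- `(ZΔ)` from the monotonicity step `{a₃} → {a₃, o}` and `Z_l ≥ 0`. -/
theorem ZDelta_of_monoStep (p : E → R) (ends : E → Sym2 V) {o a₁ a₂ a₃ b : V}
    (hstep : MonoFamily.MonoStep p ends a₁ a₂ b {a₃} o) (hl : 0 ≤ Zl p ends o a₁ a₂ a₃ b) :
    ZDelta p ends o a₁ a₂ a₃ b :=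
  ZDelta_of_Z0Zh_Zl p ends ((monoStep_a3_iff_Z0Zh p ends o a₁ a₂ a₃ b).1 hstep) hl

omit [Fintype V] in
/-- Row 2′MONO gives row 2′Z0h on every marking. -/
theorem Z0ZhNonneg_of_monoFam (p : E → R) (ends : E → Sym2 V) {a₁ a₂ b : V}
    (h : MonoFamily.MonoFam p ends a₁ a₂ b) (o a₃ : V) : Z0ZhNonneg p ends o a₁ a₂ a₃ b :=
  (monoStep_a3_iff_Z0Zh p ends o a₁ a₂ a₃ b).1 (h {a₃} o)

end MonoFamilyZ

end Summit.Ventures.PercRepro2
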